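import Summits.BirchSwinnertonDyer.Rank1Residual.X2.EulerFactorAlgebra
import Summits.BirchSwinnertonDyer.BirchSwinnertonDyer.Theorems.UniversalToricDescentLocalTermClosedForm
import Literature.NumberTheory.EllipticCurves.HasseWeilGoodReductionFrobenius
import Literature.NumberTheory.EllipticCurves.HasseWeilAbelianBadReduction
import Literature.NumberTheory.GaloisRepresentations.LocalH2VanishingTrivialModule
import HarnessLib

/-!
# Route UniversalToricDescent — the ANALYTIC local terms of act D's ♭T `DefectTransportModThree`:
# anticyclotomic Euler-factor elements `𝒫_v(T) = P_v(q_v⁻¹ (1+T)^{e_v})` over a number field,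
# `μ(𝒫_v) = 0` and `ord_T(𝒫_v mod p) = p^{v_p(e_v)} · d_v`, with `d_v` = Greenberg–Vatsal's local term
# = the engine's closed-form `s_v` (`#H¹(K_{∞,w}, E[p^∞])[p] = p^{d_v}`)

Lead prover bsd-wall-utd-p1 g12 (`--supports stmt-BirchSwinnertonDyer-26042`). The algebraic half of ♭T
(`UniversalToricDescentDefectTransportLambda`, `…OfAnalytic`) produces the Σ-terms `3^{c_v} · s_v(E)` with
`#H¹(kerD κ v, E[3^∞])[3] = 3^{s_v}` and asks the ANALYTIC half for `m + Σ_v 3^{c_v} s_v(E) = m′ + Σ_v 3^{c_v} s_v(E′)`.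
On the analytic side (Greenberg–Vatsal (1.5); anticyclotomic: Lei–Müller–Xia Lemma 3.5, Castella 2018 (3.1),
Jetchev–Skinner–Wan §5.1) the Σ-depleted `p`-adic `L`-function is `L^Σ = L · ∏_{v∈Σ} 𝒫_v` with the Euler
element `𝒫_v = P_v(N(v)⁻¹ γ_v) ∈ Λ`, `γ_v ∈ Γ` the Frobenius of the (split, finitely decomposed) place `v`,
written `(1+T)^{e_v}` (`γ_v = γ^{e_v}`, `‖e_v‖ = p^{-c_v}` when `p^{c_v}` places of `K_∞` lie over `v`).
This file is the `E`-free-algebra + local-arithmetic half of that passage, for a Weierstrass curve `W` over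
ANY number field `K`, a prime `p`, a finite place `v ∤ p` and an ABSTRACT exponent `0 ≠ e ∈ ℤ_p` (so that no
Frobenius element and no orientation of `T` has to be chosen here):

* §1 `rootMultiplicity_eulerFactorModP_eq_ite` — the multiplicity `d_v` of `q̃_v⁻¹` as a root of
  `P̃_v = P_v mod p` (`P_v = W.localPolynomialAt v`, Mathlib's local polynomial) IS the closed form of
  `UniversalToricDescentLocalTermClosedForm.natCard_pTorsion_subgroupH1_kerD_eq_pow_ite` (good / split / non-split /
  additive); hence **`natCard_pTorsion_subgroupH1_kerD_eq_pow_rootMultiplicity`**: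
  `#H¹(kerD κ v, E[p^∞])[p] = p^{d_v}` — Greenberg–Vatsal Prop. (2.4) with BOTH sides in print's currency.
* §2 `order_map_toZMod_aeval_localPolynomialAt` — `ord_T(P_v(q_v⁻¹(1+T)^e) mod p) = d_v · p^{v_p(e)}` and
  `hasUnitContent_aeval_localPolynomialAt` (`μ = 0`), from the X2 cell's `E`-free algebra
  (`X2.EulerFactorAlgebra.order_aeval_C_add`, `order_map_binomialSeries_sub_one`).
* §3 `order_map_toZMod_prod_aeval_localPolynomialAt` — the product over a finite set of places.

THEOREMS ONLY; no definition, no named fact, no `sorry`. BSD is not advanced by this file.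
References: [GreenbergVatsal2000] §1 pp. 8–9, §2 Prop. (2.4) (p. 22); [LeiMullerXia2023] (arXiv:2302.06553)
Lemma 3.5, Cor. 3.8; [Castella2018] (3.1) (arXiv:1704.06608 p. 9); [JetchevSkinnerWan2017] §5.1;
[SilvermanAEC2009] C.§16.
-/

set_option autoImplicit false
-- `…BirchSwinnertonDyer.BirchSwinnertonDyer.Theorems…` is the problem's mandated namespace (D-0017).
set_option linter.dupNamespace false

noncomputable section

open scoped Classical

namespace Summit.BirchSwinnertonDyer.BirchSwinnertonDyer.Theorems.UniversalToricDescentAcEulerFactor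

open Polynomial NumberField IsDedekindDomain WeierstrassCurve Literature.NumberTheory.EllipticCurves
  Literature.NumberTheory.EllipticCurves.GreenbergVatsal2000
  Literature.NumberTheory.EllipticCurves.GreenbergSelmer IsDedekindDomain.HeightOneSpectrum
  Summit.BirchSwinnertonDyer.Rank1Residual.X11b Summit.BirchSwinnertonDyer.Rank1Residual.X11b.Coinv
  Summit.BirchSwinnertonDyer.Rank1Residual.Iwasawa
  Summit.BirchSwinnertonDyer.Rank1Residual.X2.EulerFactorAlgebra

/-! ### §1 `d_v`: the multiplicity of `q̃_v⁻¹` as a root of `P̃_v`, by reduction type -/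

section RootMultiplicity

variable {K : Type} [Field K] [NumberField K] (W : WeierstrassCurve K) {p : ℕ} [hp : Fact p.Prime]
  (v : HeightOneSpectrum (𝓞 K))

/-- `(q : 𝔽_p) = (c : 𝔽_p) ↔ p ∣ c − q` for a natural number `q` and an integer `c`. [folklore] -/
private theorem natCast_eq_intCast_iff (q : ℕ) (c : ℤ) :
    ((q : ZMod p) = (c : ZMod p)) ↔ (p : ℤ) ∣ c - q := by
  rw [← Int.cast_natCast, ZMod.intCast_eq_intCast_iff_dvd_sub]

/-- `q_v = #k_v` is non-zero mod `p` when `v ∤ p` (it is a power of the residue characteristic of `v`).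
[folklore] -/
theorem natCast_natCard_residueField_ne_zero (hpv : ((p : ℕ) : 𝓞 K) ∉ v.asIdeal) :
    ((Nat.card (IsLocalRing.ResidueField (v.adicCompletionIntegers K)) : ℕ) : ZMod p) ≠ 0 := by
  rw [WeierstrassCurve.natCard_residueField_eq_residueCard, Ne, ZMod.natCast_eq_zero_iff]
  exact Literature.NumberTheory.GaloisRepresentations.not_dvd_residueCard_of_natCast_not_mem v hp.out hpv

variable {W v}

/-- **Additive `v`: `P̃_v = 1`, every root multiplicity is `0`.** [cite: GreenbergVatsal2000, §2 Prop. (2.4) and p. 27] -/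
theorem rootMultiplicity_eulerFactorModP_of_hasAdditiveReductionAt (hv : W.HasAdditiveReductionAt v)
    (a : ZMod p) : (eulerFactorModP W p v).rootMultiplicity a = 0 := by
  unfold eulerFactorModP
  rw [WeierstrassCurve.localPolynomialAt_of_hasAdditiveReductionAt hv, Polynomial.map_one, ← C_1,
    rootMultiplicity_C]

/-- **Split multiplicative `v ∤ p`: `P̃_v = 1 − X`, so `d_v = [p ∣ 1 − q_v]`.**
[cite: GreenbergVatsal2000, §2 Prop. (2.4) and p. 27] -/
theorem rootMultiplicity_eulerFactorModP_of_hasSplitMultiplicativeReductionAt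
    (hv : W.HasSplitMultiplicativeReductionAt v) :
    (eulerFactorModP W p v).rootMultiplicity
        (((Nat.card (IsLocalRing.ResidueField (v.adicCompletionIntegers K)) : ℕ) : ZMod p)⁻¹) =
      if (p : ℤ) ∣ 1 - (Nat.card (IsLocalRing.ResidueField (v.adicCompletionIntegers K)) : ℤ)
        then 1 else 0 := by
  unfold eulerFactorModP
  rw [WeierstrassCurve.localPolynomialAt_of_hasSplitMultiplicativeReductionAt hv, Polynomial.map_sub,
    Polynomial.map_one, Polynomial.map_X]
  have hfac : (1 - X : (ZMod p)[X]) = C (-1) * (X - C 1) := by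
    simp only [map_neg, map_one]; ring
  have hne : (C (-1) * (X - C 1) : (ZMod p)[X]) ≠ 0 :=
    mul_ne_zero (by rw [Ne, C_eq_zero]; exact neg_ne_zero.mpr one_ne_zero) (X_sub_C_ne_zero 1)
  rw [hfac, rootMultiplicity_mul hne, rootMultiplicity_C, zero_add, rootMultiplicity_X_sub_C]
  simp only [inv_eq_one]
  by_cases h1 : (p : ℤ) ∣ 1 - (Nat.card (IsLocalRing.ResidueField (v.adicCompletionIntegers K)) : ℤ)
  · rw [if_pos h1, if_pos (((natCast_eq_intCast_iff _ 1).mpr h1).trans (by push_cast; rfl))]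
  · rw [if_neg h1, if_neg (fun h ↦ h1 ((natCast_eq_intCast_iff _ 1).mp (h.trans (by push_cast; rfl))))]

/-- **Non-split multiplicative `v ∤ p`: `P̃_v = 1 + X`, so `d_v = [p ∣ −1 − q_v]`.**
[cite: GreenbergVatsal2000, §2 Prop. (2.4) and p. 27] -/
theorem rootMultiplicity_eulerFactorModP_of_hasNonsplitMultiplicativeReductionAt
    (hv : W.HasMultiplicativeReductionAt v) (hns : ¬ W.HasSplitMultiplicativeReductionAt v) :
    (eulerFactorModP W p v).rootMultiplicity
        (((Nat.card (IsLocalRing.ResidueField (v.adicCompletionIntegers K)) : ℕ) : ZMod p)⁻¹) =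
      if (p : ℤ) ∣ -1 - (Nat.card (IsLocalRing.ResidueField (v.adicCompletionIntegers K)) : ℤ)
        then 1 else 0 := by
  unfold eulerFactorModP
  rw [WeierstrassCurve.localPolynomialAt_of_hasMultiplicativeReductionAt_of_not_hasSplitMultiplicativeReductionAt
    hv hns, Polynomial.map_add, Polynomial.map_one, Polynomial.map_X]
  have hfac : (1 + X : (ZMod p)[X]) = X - C (-1) := by
    simp only [map_neg, map_one]; ring
  rw [hfac, rootMultiplicity_X_sub_C]
  simp only [inv_eq_iff_eq_inv, inv_neg, inv_one]
  by_cases h1 : (p : ℤ) ∣ -1 - (Nat.card (IsLocalRing.ResidueField (v.adicCompletionIntegers K)) : ℤ)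
  · rw [if_pos h1, if_pos (((natCast_eq_intCast_iff _ (-1)).mpr h1).trans (by push_cast; rfl))]
  · rw [if_neg h1,
      if_neg (fun h ↦ h1 ((natCast_eq_intCast_iff _ (-1)).mp (h.trans (by push_cast; rfl))))]

/-- `P̃_v = 1 − ã_v X + q̃_v X²` at a good place (`a_v = W.frobeniusTraceAt v`, `q_v = #k_v`).
[cite: GreenbergVatsal2000, §2 Prop. (2.4)] -/
theorem eulerFactorModP_of_hasGoodReductionAt (hv : W.HasGoodReductionAt v) :
    eulerFactorModP W p v =
      1 - C ((W.frobeniusTraceAt v : ℤ) : ZMod p) * X +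
        C (((Nat.card (IsLocalRing.ResidueField (v.adicCompletionIntegers K)) : ℕ) : ZMod p)) * X ^ 2 := by
  unfold eulerFactorModP
  rw [WeierstrassCurve.localPolynomialAt_of_hasGoodReductionAt hv]
  simp only [Polynomial.map_add, Polynomial.map_sub, Polynomial.map_one, Polynomial.map_mul,
    Polynomial.map_pow, Polynomial.map_C, Polynomial.map_X, Int.coe_castRingHom, Int.cast_natCast]

/-- **Good `v ∤ p`: `d_v = 0` if `p ∤ q_v + 1 − a_v`; else `2` if `p ∣ q_v − 1`, else `1`** (`P̃_v(q̃⁻¹) =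
q̃⁻¹(q + 1 − a)~`; when it vanishes `P̃_v = q̃ (X − q̃⁻¹)(X − 1)`). [cite: GreenbergVatsal2000, §2 Prop. (2.4) and p. 27] -/
theorem rootMultiplicity_eulerFactorModP_of_hasGoodReductionAt (hv : W.HasGoodReductionAt v)
    (hpv : ((p : ℕ) : 𝓞 K) ∉ v.asIdeal) :
    (eulerFactorModP W p v).rootMultiplicity
        (((Nat.card (IsLocalRing.ResidueField (v.adicCompletionIntegers K)) : ℕ) : ZMod p)⁻¹) =
      if (p : ℤ) ∣ (Nat.card (IsLocalRing.ResidueField (v.adicCompletionIntegers K)) : ℤ) + 1 -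
            W.frobeniusTraceAt v then
        (if (p : ℤ) ∣ (Nat.card (IsLocalRing.ResidueField (v.adicCompletionIntegers K)) : ℤ) - 1
          then 2 else 1)
        else 0 := by
  have hq0 := natCast_natCard_residueField_ne_zero v hpv
  set q : ℕ := Nat.card (IsLocalRing.ResidueField (v.adicCompletionIntegers K)) with hqdef
  set l : ZMod p := (q : ZMod p) with hl
  by_cases hdvd : (p : ℤ) ∣ (q : ℤ) + 1 - W.frobeniusTraceAt v
  · rw [if_pos hdvd]
    have ha : ((W.frobeniusTraceAt v : ℤ) : ZMod p) = l + 1 := by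
      have h0 : (((q + 1 - W.frobeniusTraceAt v : ℤ)) : ZMod p) = 0 :=
        (ZMod.intCast_zmod_eq_zero_iff_dvd _ p).mpr hdvd
      push_cast at h0
      linear_combination -h0
    have hfac : eulerFactorModP W p v = C l * (X - C l⁻¹) * (X - C 1) := by
      rw [eulerFactorModP_of_hasGoodReductionAt hv, ha]
      have key : (C l * C l⁻¹ : (ZMod p)[X]) = 1 := by rw [← C_mul, mul_inv_cancel₀ hq0, C_1]
      simp only [map_add, map_one]
      linear_combination (X - 1 : (ZMod p)[X]) * key
    have hne1 : (C l * (X - C l⁻¹) : (ZMod p)[X]) ≠ 0 :=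
      mul_ne_zero (by rw [Ne, C_eq_zero]; exact hq0) (X_sub_C_ne_zero _)
    have hne : (C l * (X - C l⁻¹) * (X - C 1) : (ZMod p)[X]) ≠ 0 := mul_ne_zero hne1 (X_sub_C_ne_zero 1)
    rw [hfac, rootMultiplicity_mul hne, rootMultiplicity_mul hne1, rootMultiplicity_C, zero_add,
      rootMultiplicity_X_sub_C_self, rootMultiplicity_X_sub_C]
    simp only [inv_eq_one]
    by_cases h1 : (p : ℤ) ∣ (q : ℤ) - 1
    · rw [if_pos h1, if_pos ((natCast_eq_intCast_iff _ 1).mpr (by rwa [dvd_sub_comm]) |>.trans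
        (by push_cast; rfl))]
    · rw [if_neg h1, if_neg (fun h ↦ h1 ?_)]
      rw [dvd_sub_comm]
      exact (natCast_eq_intCast_iff _ 1).mp (h.trans (by push_cast; rfl))
  · rw [if_neg hdvd, rootMultiplicity_eq_zero_iff, IsRoot.def, eulerFactorModP_of_hasGoodReductionAt hv]
    intro heval
    exfalso
    apply hdvd
    rw [← ZMod.intCast_zmod_eq_zero_iff_dvd]
    simp only [eval_add, eval_sub, eval_one, eval_mul, eval_C, eval_X, eval_pow] at heval
    have h2 : (l : ZMod p) * (1 - (W.frobeniusTraceAt v : ZMod p) * l⁻¹ + l * (l⁻¹) ^ 2) =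
        (((q : ℤ) + 1 - W.frobeniusTraceAt v : ℤ) : ZMod p) := by
      push_cast
      field_simp
      ring
    rw [← h2, heval, mul_zero]

variable (W v) in
/-- **`d_v` in closed form**: at a place `v ∤ p`, the multiplicity of `q̃_v⁻¹` as a root of `P̃_v` is the
exponent of `UniversalToricDescentLocalTermClosedForm.natCard_pTorsion_subgroupH1_kerD_eq_pow_ite` — good:
`0 / 2 / 1` by `p ∣ q+1−a`, `p ∣ q−1`; split multiplicative `[p ∣ 1−q]`; non-split `[p ∣ −1−q]`; additive `0`.
[cite: GreenbergVatsal2000, §2 Prop. (2.4) (p. 22) and p. 27] -/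
theorem rootMultiplicity_eulerFactorModP_eq_ite (hpv : ((p : ℕ) : 𝓞 K) ∉ v.asIdeal) :
    (eulerFactorModP W p v).rootMultiplicity
        (((Nat.card (IsLocalRing.ResidueField (v.adicCompletionIntegers K)) : ℕ) : ZMod p)⁻¹) =
      (if W.HasGoodReductionAt v then
          (if (p : ℤ) ∣ (Nat.card (IsLocalRing.ResidueField (v.adicCompletionIntegers K)) : ℤ) + 1 -
                W.frobeniusTraceAt v then
            (if (p : ℤ) ∣ (Nat.card (IsLocalRing.ResidueField (v.adicCompletionIntegers K)) : ℤ) - 1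
              then 2 else 1)
            else 0)
        else if W.HasSplitMultiplicativeReductionAt v then
          (if (p : ℤ) ∣ 1 - (Nat.card (IsLocalRing.ResidueField (v.adicCompletionIntegers K)) : ℤ)
            then 1 else 0)
        else if W.HasMultiplicativeReductionAt v then
          (if (p : ℤ) ∣ -1 - (Nat.card (IsLocalRing.ResidueField (v.adicCompletionIntegers K)) : ℤ)
            then 1 else 0)
        else 0) := by
  rcases hasGoodReductionAt_or_hasMultiplicativeReductionAt_or_hasAdditiveReductionAt v W with
    hg | hm | ha
  · rw [if_pos hg, rootMultiplicity_eulerFactorModP_of_hasGoodReductionAt hg hpv]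
  · rw [if_neg hm.not_hasGoodReductionAt]
    by_cases hs : W.HasSplitMultiplicativeReductionAt v
    · rw [if_pos hs, rootMultiplicity_eulerFactorModP_of_hasSplitMultiplicativeReductionAt hs]
    · rw [if_neg hs, if_pos hm, rootMultiplicity_eulerFactorModP_of_hasNonsplitMultiplicativeReductionAt hm hs]
  · have hng : ¬ W.HasGoodReductionAt v := ha.not_hasGoodReductionAt
    have hnm : ¬ W.HasMultiplicativeReductionAt v := fun h ↦ h.not_hasAdditiveReductionAt ha
    have hns : ¬ W.HasSplitMultiplicativeReductionAt v := fun h ↦ hnm h.hasMultiplicativeReductionAt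
    rw [if_neg hng, if_neg hns, if_neg hnm, rootMultiplicity_eulerFactorModP_of_hasAdditiveReductionAt ha]

/-- `d_v ≤ 2`. [cite: GreenbergVatsal2000, §2 Prop. (2.4)] -/
theorem rootMultiplicity_eulerFactorModP_le_two (hpv : ((p : ℕ) : 𝓞 K) ∉ v.asIdeal) :
    (eulerFactorModP W p v).rootMultiplicity
        (((Nat.card (IsLocalRing.ResidueField (v.adicCompletionIntegers K)) : ℕ) : ZMod p)⁻¹) ≤ 2 := by
  rw [rootMultiplicity_eulerFactorModP_eq_ite W v hpv]
  split_ifs <;> omega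

variable (W v) in
/-- **Greenberg–Vatsal Prop. (2.4) with both sides in print's currency**: for an elliptic curve `E = W/K`, a
`ℤ_p`-extension `κ` of `K` and a place `v ∤ p` finitely decomposed in `κ`,
`#{f ∈ H¹(kerD κ v, E[p^∞]) : p • f = 0} = p^{d_v}` with `d_v` the multiplicity of `q̃_v⁻¹` as a root of the
reduced Euler factor `P̃_v` — the exponent the Σ-depleted `p`-adic `L`-function loses at `v` per place of `K_∞`.
[cite: GreenbergVatsal2000, §2 Prop. (2.4) (p. 22)] [cite: GreenbergLNM1716, §3 Lemma 3.3] -/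
theorem natCard_pTorsion_subgroupH1_kerD_eq_pow_rootMultiplicity [W.IsElliptic] (κ : ZpExtension K p)
    (hpv : ((p : ℕ) : 𝓞 K) ∉ v.asIdeal) (hD : ¬ (decomp v ≤ κ.kerSubgroup)) :
    Nat.card {f : Literature.NumberTheory.EllipticCurves.subgroupH1 (kerD κ v)
        (W.geomPrimaryTorsion p) // p • f = 0} =
      p ^ (eulerFactorModP W p v).rootMultiplicity
        (((Nat.card (IsLocalRing.ResidueField (v.adicCompletionIntegers K)) : ℕ) : ZMod p)⁻¹) := by
  rw [UniversalToricDescentLocalTermClosedForm.natCard_pTorsion_subgroupH1_kerD_eq_pow_ite W κ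
      (by exact_mod_cast hpv) hD, rootMultiplicity_eulerFactorModP_eq_ite W v hpv]

end RootMultiplicity

/-! ### §2 The Euler element `P_v(q_v⁻¹ (1+T)^e)`: reduction mod `p`, `T`-order, unit content -/

section EulerElement

variable {K : Type} [Field K] [NumberField K] (W : WeierstrassCurve K) {p : ℕ} [hp : Fact p.Prime]
  (v : HeightOneSpectrum (𝓞 K))

/-- Reduction of `q⁻¹ ∈ ℤ_p` (`PadicInt.inv`) is `q̃⁻¹ ∈ 𝔽_p` for `q` prime to `p`. [folklore] -/
theorem toZMod_inv_natCast {q : ℕ} (hq : ((q : ℕ) : ZMod p) ≠ 0) :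
    PadicInt.toZMod ((q : ℤ_[p]).inv) = ((q : ZMod p))⁻¹ := by
  have hcop : p.Coprime q := by
    rw [Nat.Prime.coprime_iff_not_dvd hp.out, ← ZMod.natCast_eq_zero_iff]; exact hq
  have hnorm : ‖(q : ℤ_[p])‖ = 1 := PadicInt.norm_natCast_eq_one_iff.mpr hcop
  have hmul : PadicInt.toZMod (p := p) (q : ℤ_[p]) * PadicInt.toZMod ((q : ℤ_[p]).inv) = 1 := by
    rw [← map_mul, PadicInt.mul_inv hnorm, map_one]
  rw [map_natCast] at hmul
  exact (eq_inv_of_mul_eq_one_right hmul)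

/-- **`𝒫 mod p = P̃_v(q̃_v⁻¹ · ((1+T)^e mod p))`** for `𝒫 = P_v(q_v⁻¹ (1+T)^e) ∈ Λ = ℤ_p⟦T⟧` (reduction is a
ring map; `P_v ∈ ℤ[X]`). [cite: GreenbergVatsal2000, §1 p. 9] -/
theorem map_toZMod_aeval_localPolynomialAt (hpv : ((p : ℕ) : 𝓞 K) ∉ v.asIdeal) (e : ℤ_[p]) :
    PowerSeries.map (PadicInt.toZMod (p := p))
        (Polynomial.aeval
          (PowerSeries.C ((Nat.card (IsLocalRing.ResidueField (v.adicCompletionIntegers K)) : ℤ_[p]).inv) *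
            PowerSeries.binomialSeries ℤ_[p] e)
          (W.localPolynomialAt v) : IwasawaAlgebra p) =
      Polynomial.aeval
        (PowerSeries.C
            (((Nat.card (IsLocalRing.ResidueField (v.adicCompletionIntegers K)) : ℕ) : ZMod p))⁻¹ *
          PowerSeries.map (PadicInt.toZMod (p := p)) (PowerSeries.binomialSeries ℤ_[p] e))
        (eulerFactorModP W p v) := by
  rw [Polynomial.aeval_def, Polynomial.hom_eval₂, eulerFactorModP, Polynomial.aeval_def, Polynomial.eval₂_map]
  congr 1
  · exact RingHom.ext_int _ _
  · rw [map_mul, PowerSeries.map_C, toZMod_inv_natCast (natCast_natCard_residueField_ne_zero v hpv)]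

/-- **`ord_T(P_v(q_v⁻¹(1+T)^e) mod p) = d_v · p^{v_p(e)}`** for `v ∤ p` and `0 ≠ e ∈ ℤ_p`: `𝒫 mod p =
P̃_v(q̃⁻¹ + ε)` with `ε = q̃⁻¹((1+T)^e − 1) mod p` of `T`-order `p^{v_p(e)}`, and
`ord_T P̃(a + ε) = mult_a(P̃) · ord_T ε` — Greenberg–Vatsal Prop. (2.4) ("Its `λ`-invariant is equal to
`s_ℓ d_ℓ`"), anticyclotomic reading `λ(𝒫_v) = (#places of K_∞ over v) · d_v`.
[cite: GreenbergVatsal2000, §2 Prop. (2.4) (p. 22)] [cite: LeiMullerXia2023, Lemma 3.5] -/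
theorem order_map_toZMod_aeval_localPolynomialAt (hpv : ((p : ℕ) : 𝓞 K) ∉ v.asIdeal) {e : ℤ_[p]}
    (he : e ≠ 0) :
    (PowerSeries.map (PadicInt.toZMod (p := p))
        (Polynomial.aeval
          (PowerSeries.C ((Nat.card (IsLocalRing.ResidueField (v.adicCompletionIntegers K)) : ℤ_[p]).inv) *
            PowerSeries.binomialSeries ℤ_[p] e)
          (W.localPolynomialAt v) : IwasawaAlgebra p)).order =
      (((eulerFactorModP W p v).rootMultiplicity
          (((Nat.card (IsLocalRing.ResidueField (v.adicCompletionIntegers K)) : ℕ) : ZMod p)⁻¹) *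
        p ^ e.valuation : ℕ) : ℕ∞) := by
  have hq0 := natCast_natCard_residueField_ne_zero v hpv
  -- `P̃_v ≠ 0`: its constant term is `1` (over `ℚ`: `X2.EulerFactorInvariants.eulerFactorModP_ne_zero`)
  have hP0 : eulerFactorModP W p v ≠ 0 := by
    intro h
    have h0 := congrArg (fun P : (ZMod p)[X] ↦ P.coeff 0) h
    have h1 : (W.localPolynomialAt v).coeff 0 = 1 := by
      rcases hasGoodReductionAt_or_hasMultiplicativeReductionAt_or_hasAdditiveReductionAt v W with
        hg | hm | ha
      · rw [WeierstrassCurve.localPolynomialAt_of_hasGoodReductionAt hg]; simp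
      · by_cases hs : W.HasSplitMultiplicativeReductionAt v
        · rw [WeierstrassCurve.localPolynomialAt_of_hasSplitMultiplicativeReductionAt hs]; simp
        · rw [WeierstrassCurve.localPolynomialAt_of_hasMultiplicativeReductionAt_of_not_hasSplitMultiplicativeReductionAt
            hm hs]; simp
      · rw [WeierstrassCurve.localPolynomialAt_of_hasAdditiveReductionAt ha]; simp
    simp only [eulerFactorModP, Polynomial.coeff_map, h1, map_one, Polynomial.coeff_zero] at h0
    exact one_ne_zero h0
  set q : ℕ := Nat.card (IsLocalRing.ResidueField (v.adicCompletionIntegers K)) with hqdef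
  set a : ZMod p := ((q : ZMod p))⁻¹ with ha
  set G := PowerSeries.map (PadicInt.toZMod (p := p)) (PowerSeries.binomialSeries ℤ_[p] e) with hG
  have hsplit : PowerSeries.C a * G = PowerSeries.C a + PowerSeries.C a * (G - 1) := by ring
  have hG0 : PowerSeries.constantCoeff G = 1 := by
    rw [hG, ← PowerSeries.coeff_zero_eq_constantCoeff_apply, PowerSeries.coeff_map,
      PowerSeries.binomialSeries_coeff, Ring.choose_zero_right, one_smul, map_one]
  have hε0 : PowerSeries.constantCoeff (PowerSeries.C a * (G - 1)) = 0 := by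
    rw [map_mul, map_sub, hG0, map_one, sub_self, mul_zero]
  have ha0 : a ≠ 0 := by rw [ha]; exact inv_ne_zero hq0
  have hεord : (PowerSeries.C a * (G - 1)).order = ((p ^ e.valuation : ℕ) : ℕ∞) := by
    rw [PowerSeries.order_mul, PowerSeries.order_zero_of_unit
      ((PowerSeries.isUnit_iff_constantCoeff).mpr (by rwa [PowerSeries.constantCoeff_C, isUnit_iff_ne_zero])),
      zero_add, hG, order_map_binomialSeries_sub_one p he, Nat.cast_pow]
  rw [map_toZMod_aeval_localPolynomialAt W v hpv, ← hG, hsplit,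
    order_aeval_C_add hP0 a hε0, hεord, Nat.cast_mul]

/-- **`P_v(q_v⁻¹(1+T)^e)` has unit content (`μ = 0`, "not divisible by `p`")** for `v ∤ p`, `e ≠ 0`.
[cite: GreenbergVatsal2000, §1 p. 9 and §2 Prop. (2.4)] -/
theorem hasUnitContent_aeval_localPolynomialAt (hpv : ((p : ℕ) : 𝓞 K) ∉ v.asIdeal) {e : ℤ_[p]}
    (he : e ≠ 0) :
    HasUnitContent
      (Polynomial.aeval
        (PowerSeries.C ((Nat.card (IsLocalRing.ResidueField (v.adicCompletionIntegers K)) : ℤ_[p]).inv) *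
          PowerSeries.binomialSeries ℤ_[p] e)
        (W.localPolynomialAt v) : IwasawaAlgebra p) := by
  rw [hasUnitContent_iff_map_toZMod_ne_zero]
  intro h
  have := order_map_toZMod_aeval_localPolynomialAt W v hpv he
  rw [h, PowerSeries.order_zero] at this
  exact ENat.top_ne_coe _ this

end EulerElement

/-! ### §3 The product over a finite set of places -/

section Product

variable {K : Type} [Field K] [NumberField K] (W : WeierstrassCurve K) {p : ℕ} [hp : Fact p.Prime]

/-- **`ord_T(∏_{v∈T} P_v(q_v⁻¹(1+T)^{e_v}) mod p) = Σ_{v∈T} d_v · p^{v_p(e_v)}`** and the product has unit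
content, for a finite set `T` of places `v ∤ p` and exponents `e_v ≠ 0` (Greenberg–Vatsal display (9),
`λ^{anal}_{E,Σ} = λ^{anal}_E + Σ δ`; Lei–Müller–Xia Lemma 3.5 / Cor. 3.8, anticyclotomic).
[cite: GreenbergVatsal2000, §1 p. 9 display (9)] [cite: LeiMullerXia2023, Lemma 3.5 and Cor. 3.8] -/
theorem order_map_toZMod_prod_aeval_localPolynomialAt (T : Finset (HeightOneSpectrum (𝓞 K)))
    (hT : ∀ v ∈ T, ((p : ℕ) : 𝓞 K) ∉ v.asIdeal) (e : HeightOneSpectrum (𝓞 K) → ℤ_[p])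
    (he : ∀ v ∈ T, e v ≠ 0) :
    HasUnitContent
        (∏ v ∈ T, (Polynomial.aeval
          (PowerSeries.C ((Nat.card (IsLocalRing.ResidueField (v.adicCompletionIntegers K)) : ℤ_[p]).inv) *
            PowerSeries.binomialSeries ℤ_[p] (e v))
          (W.localPolynomialAt v) : IwasawaAlgebra p)) ∧
      (PowerSeries.map (PadicInt.toZMod (p := p))
          (∏ v ∈ T, (Polynomial.aeval
            (PowerSeries.C ((Nat.card (IsLocalRing.ResidueField (v.adicCompletionIntegers K)) : ℤ_[p]).inv) *
              PowerSeries.binomialSeries ℤ_[p] (e v))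
            (W.localPolynomialAt v) : IwasawaAlgebra p))).order =
        ((∑ v ∈ T, (eulerFactorModP W p v).rootMultiplicity
            (((Nat.card (IsLocalRing.ResidueField (v.adicCompletionIntegers K)) : ℕ) : ZMod p)⁻¹) *
          p ^ (e v).valuation : ℕ) : ℕ∞) := by
  induction T using Finset.induction_on with
  | empty =>
    refine ⟨⟨0, ?_⟩, ?_⟩
    · rw [Finset.prod_empty, PowerSeries.coeff_zero_eq_constantCoeff, map_one]
      exact isUnit_one
    · rw [Finset.prod_empty, map_one, PowerSeries.order_one, Finset.sum_empty, Nat.cast_zero]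
  | insert v S hv ih =>
    obtain ⟨ihu, iho⟩ := ih (fun w hw ↦ hT w (Finset.mem_insert_of_mem hw))
      (fun w hw ↦ he w (Finset.mem_insert_of_mem hw))
    have hvp := hT v (Finset.mem_insert_self v S)
    have hve := he v (Finset.mem_insert_self v S)
    refine ⟨?_, ?_⟩
    · rw [Finset.prod_insert hv, hasUnitContent_mul_iff]
      exact ⟨hasUnitContent_aeval_localPolynomialAt W v hvp hve, ihu⟩
    · rw [Finset.prod_insert hv, map_mul, PowerSeries.order_mul, iho,
        order_map_toZMod_aeval_localPolynomialAt W v hvp hve, Finset.sum_insert hv, Nat.cast_add]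

end Product

end Summit.BirchSwinnertonDyer.BirchSwinnertonDyer.Theorems.UniversalToricDescentAcEulerFactor

end
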